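import Mathlib
import Literature.Geometry.DiscreteGeometry.KissingPatterns
import Summits.AtomisticToContinuum.Crystallization.Theses.DisclinationRation

/-!
# Route `DisclinationRation`, crux `FiveFoldRation` (stmt-AtomisticToContinuum-15799) — posited objects, named

Definitions posited by the route decl `DisclinationRation.FiveFoldRation` (K2, "flat space rations five-fold axes")
and by line `Sketch` of its crux (lead prover-line-stmt-AtomisticToContinuum-15799-0, 2026-08-17).  So far every
one of them lived INLINE — in the route decl and, `let`-abbreviated, in the registered stub signatures of
`Cruxes/FiveFoldRation/Lines/Sketch.lean` and the landed files `Theorems/DisclinationRationFiveFoldRationStub*.lean`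
(registry cap: 4000 characters per stub).  This file NAMES them so that the remaining global statements (octet
cellulation, axis census, the core of line `Sketch`) can be typed readably; the `*_iff` / `rfl` lemmas show that the
named forms ARE the inline forms (`fiveFoldRation_iff` is `Iff.rfl`).

* `decaPattern` — the 12-point decahedral-axis pattern (bicapped pentagonal prism: poles `±e₃`, two ALIGNED pentagonal
  rings at heights `±1/2`, radius `√3/2`), verbatim the route decl's third alphabet letter.
* `nearestDist S y` (`d_y`), `firstShell S y` (`T_y = {z ∈ S : z ≠ y, |z − y| < 13/10·d_y}`).
* `IsTolMatching S y A v e` — the `1/20`-tolerance matching of the rescaled first shell of `y` onto a pattern indexed by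
  `e` (an equivalence) with embedding `v` after the linear isometry `A`; `IsAlphabetGood` / `IsFccHcpGood` (the route
  decl's `GA` / `GF`), `axisSites S` (the counted set), `axisCount S c ρ` (its size in `B̄_ρ(c)`), `IsAdmissible δ S`.
* Line-`Sketch` notions: `IsSquareFace` (induced 4-cycle of shell-adjacency in a link = half an octahedron),
  `IsPolePair` (a decahedral matching of the shell of `y` puts `z` at a pole: the five-fold bonds), `FrontEnd S` (the
  conjunction of the LANDED per-`S` front end: shell symmetry, links, capping, columns), `LayerInequality S` (the
  conclusion of the open core stub).

Design: plain `def`s (delta-reducible), so every landed `let`-style statement specialises to these by `rfl`; nothing is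
proved here beyond unfolding lemmas.  NOT here: the ideal octet complex `K(S)` as a metric space and the census engine —
the subject of the crux's re-lining memo `Cruxes/FiveFoldRation/NOTES.md`.
-/

noncomputable section

open scoped Classical

namespace Summit.AtomisticToContinuum.Crystallization.Theorems.FiveFoldRation

open Literature.Geometry.DiscreteGeometry (fccKissingPattern hcpKissingPattern)

/-- Ambient space `ℝ³` (reducible abbreviation). [folklore] -/
abbrev E3 : Type := EuclideanSpace ℝ (Fin 3)

/-! ## The alphabet and the shell -/

/-- **The decahedral-axis pattern** `Deca`: the twelve unit vectors `±e₃` and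
`(√3/2·cos(2πk/5), √3/2·sin(2πk/5), ±1/2)`, `k < 5` — the first shell of a site on a five-fold twin axis (two poles on
the axis, two aligned pentagonal rings). Verbatim the third letter of the route decl's alphabet
(route-posited object, crux stmt-AtomisticToContinuum-15799). [folklore] -/
def decaPattern : Set E3 :=
  {p : E3 | p = !₂[(0 : ℝ), 0, 1] ∨ p = !₂[(0 : ℝ), 0, -1] ∨ ∃ k : Fin 5, ∃ σ : ℝ, (σ = 1 / 2 ∨ σ = -(1 / 2)) ∧
    p = !₂[Real.sqrt 3 / 2 * Real.cos (2 * Real.pi * (k : ℝ) / 5), Real.sqrt 3 / 2 * Real.sin (2 * Real.pi * (k : ℝ) / 5), σ]}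

/-- **Nearest-neighbour distance** `d_y = inf {dist z y : z ∈ S, z ≠ y}` (the route decl's `let d`). [folklore] -/
def nearestDist (S : Set E3) (y : E3) : ℝ := sInf ((fun z => dist z y) '' (S \ {y}))

/-- **First shell** `T_y = {z ∈ S : z ≠ y, dist z y < 13/10 · d_y}` (the route decl's `let T`). [folklore] -/
def firstShell (S : Set E3) (y : E3) : Set E3 := {z : E3 | z ∈ S ∧ z ≠ y ∧ dist z y < 13 / 10 * nearestDist S y}

/-- **Tolerance matching**: the first shell of `y`, recentred and rescaled by `d_y`, is moved pointwise by at most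
`1/20` onto the pattern `v ∘ e` after the linear isometry `A` (`e` a bijection onto the pattern's index type, `v` its
embedding in `ℝ³`; for the three letters `v = Subtype.val`). [folklore] -/
def IsTolMatching (S : Set E3) (y : E3) (A : E3 →ₗᵢ[ℝ] E3) {ι : Type*} (v : ι → E3) (e : ↥(firstShell S y) ≃ ι) : Prop :=
  ∀ t : ↥(firstShell S y), dist ((nearestDist S y)⁻¹ • ((t : E3) - y)) (A (v (e t))) ≤ 1 / 20

/-- **Alphabet-good** (the route decl's `GA`): the shell of `y` is `1/20`-matched to fcc, hcp or `decaPattern`. [folklore] -/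
def IsAlphabetGood (S : Set E3) (y : E3) : Prop :=
  ∃ A : E3 →ₗᵢ[ℝ] E3,
    (∃ e : ↥(firstShell S y) ≃ ↥fccKissingPattern, IsTolMatching S y A Subtype.val e) ∨
    (∃ e : ↥(firstShell S y) ≃ ↥hcpKissingPattern, IsTolMatching S y A Subtype.val e) ∨
    (∃ e : ↥(firstShell S y) ≃ ↥decaPattern, IsTolMatching S y A Subtype.val e)

/-- **{fcc,hcp}-good** (the route decl's `GF`). [folklore] -/
def IsFccHcpGood (S : Set E3) (y : E3) : Prop :=
  ∃ A : E3 →ₗᵢ[ℝ] E3,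
    (∃ e : ↥(firstShell S y) ≃ ↥fccKissingPattern, IsTolMatching S y A Subtype.val e) ∨
    (∃ e : ↥(firstShell S y) ≃ ↥hcpKissingPattern, IsTolMatching S y A Subtype.val e)

/-- **Axis sites**: the sites of `S` that are not {fcc,hcp}-good (the counted set of the crux; in an
everywhere-alphabet-good `S` these are exactly the decahedrally matched sites). [folklore] -/
def axisSites (S : Set E3) : Set E3 := {y : E3 | y ∈ S ∧ ¬ IsFccHcpGood S y}

/-- **Axis count** `Nax S c ρ = #(axisSites S ∩ B̄_ρ(c))` as a real number (`Set.ncard`; finite for separated `S`). [folklore] -/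
def axisCount (S : Set E3) (c : E3) (ρ : ℝ) : ℝ := ((axisSites S ∩ Metric.closedBall c ρ).ncard : ℝ)

/-- **Admissible class of the crux**: `δ`-separated, relatively dense, everywhere alphabet-good. [folklore] -/
def IsAdmissible (δ : ℝ) (S : Set E3) : Prop :=
  (∀ y ∈ S, ∀ z ∈ S, y ≠ z → δ ≤ dist y z) ∧ (∃ R₁ : ℝ, ∀ p : E3, ∃ y ∈ S, dist y p ≤ R₁) ∧ ∀ y ∈ S, IsAlphabetGood S y

/-! ## Unfolding lemmas -/

/-- Membership in the first shell. -/
theorem mem_firstShell {S : Set E3} {y z : E3} :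
    z ∈ firstShell S y ↔ z ∈ S ∧ z ≠ y ∧ dist z y < 13 / 10 * nearestDist S y := Iff.rfl

/-- The first shell lies in `S`. -/
theorem firstShell_subset (S : Set E3) (y : E3) : firstShell S y ⊆ S := fun _ hz => hz.1

/-- Membership in the axis set. -/
theorem mem_axisSites {S : Set E3} {y : E3} : y ∈ axisSites S ↔ y ∈ S ∧ ¬ IsFccHcpGood S y := Iff.rfl

/-- {fcc,hcp}-good sites are alphabet-good. -/
theorem IsFccHcpGood.isAlphabetGood {S : Set E3} {y : E3} (h : IsFccHcpGood S y) : IsAlphabetGood S y := by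
  obtain ⟨A, h | h⟩ := h
  · exact ⟨A, Or.inl h⟩
  · exact ⟨A, Or.inr (Or.inl h)⟩

/-- An alphabet-good axis site is decahedrally matched. -/
theorem exists_deca_of_isAlphabetGood_of_not {S : Set E3} {y : E3} (h : IsAlphabetGood S y) (hn : ¬ IsFccHcpGood S y) :
    ∃ A : E3 →ₗᵢ[ℝ] E3, ∃ e : ↥(firstShell S y) ≃ ↥decaPattern, IsTolMatching S y A Subtype.val e := by
  obtain ⟨A, h | h | h⟩ := h
  · exact absurd ⟨A, Or.inl h⟩ hn
  · exact absurd ⟨A, Or.inr h⟩ hn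
  · exact ⟨A, h⟩

/-- **The crux, read through the named predicates** — definitional (`Iff.rfl`). -/
theorem fiveFoldRation_iff :
    Summit.AtomisticToContinuum.Crystallization.Theses.DisclinationRation.FiveFoldRation ↔
      ∀ δ : ℝ, 0 < δ → ∀ S : Set E3, (∀ y ∈ S, ∀ z ∈ S, y ≠ z → δ ≤ dist y z) →
        (∃ R₁ : ℝ, ∀ p : E3, ∃ y ∈ S, dist y p ≤ R₁) → (∀ y ∈ S, IsAlphabetGood S y) →
        ∀ θ : ℝ, 0 < θ → ∃ L₀ : ℝ, ∀ L : ℝ, L₀ ≤ L → ∀ c : E3,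
          (({y : E3 | y ∈ S ∧ dist y c ≤ L ∧ ¬ IsFccHcpGood S y} : Set E3).ncard : ℝ) ≤ θ * L ^ 3 :=
  Iff.rfl

/-- The counted set of the crux is `axisSites S ∩ B̄_L(c)`. -/
theorem countedSet_eq (S : Set E3) (c : E3) (L : ℝ) :
    ({y : E3 | y ∈ S ∧ dist y c ≤ L ∧ ¬ IsFccHcpGood S y} : Set E3) = axisSites S ∩ Metric.closedBall c L := by
  ext y
  simp only [axisSites, Set.mem_setOf_eq, Set.mem_inter_iff, Metric.mem_closedBall]
  tauto

/-- The crux in the form "the axis count is eventually `≤ θ L³`, uniformly in the centre". -/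
theorem fiveFoldRation_iff_axisCount :
    Summit.AtomisticToContinuum.Crystallization.Theses.DisclinationRation.FiveFoldRation ↔
      ∀ δ : ℝ, 0 < δ → ∀ S : Set E3, IsAdmissible δ S →
        ∀ θ : ℝ, 0 < θ → ∃ L₀ : ℝ, ∀ L : ℝ, L₀ ≤ L → ∀ c : E3, axisCount S c L ≤ θ * L ^ 3 := by
  rw [fiveFoldRation_iff]
  constructor
  · intro h δ hδ S hS θ hθ
    obtain ⟨L₀, hL₀⟩ := h δ hδ S hS.1 hS.2.1 hS.2.2 θ hθ
    exact ⟨L₀, fun L hL c => by rw [axisCount, ← countedSet_eq]; exact hL₀ L hL c⟩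
  · intro h δ hδ S hsep hdense hgood θ hθ
    obtain ⟨L₀, hL₀⟩ := h δ hδ S ⟨hsep, hdense, hgood⟩ θ hθ
    exact ⟨L₀, fun L hL c => by rw [countedSet_eq]; exact hL₀ L hL c⟩

/-! ## Line `Sketch`: local structures and the two sides of its open core -/

/-- **Square face of the link of `y`**: four shell points of `y`, consecutively shell-adjacent, with both diagonals
NOT shell-adjacent and opposite corners distinct — by the landed link lemma exactly the square / rectangular faces of
the cuboctahedron, anticuboctahedron or prism; half an octahedron of the octet cellulation (capped by
`stub_dr5_capping`). [folklore] -/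
def IsSquareFace (S : Set E3) (y t₁ t₂ t₃ t₄ : E3) : Prop :=
  t₁ ∈ firstShell S y ∧ t₂ ∈ firstShell S y ∧ t₃ ∈ firstShell S y ∧ t₄ ∈ firstShell S y ∧
    t₂ ∈ firstShell S t₁ ∧ t₃ ∈ firstShell S t₂ ∧ t₄ ∈ firstShell S t₃ ∧ t₁ ∈ firstShell S t₄ ∧
    t₃ ∉ firstShell S t₁ ∧ t₄ ∉ firstShell S t₂ ∧ t₁ ≠ t₃ ∧ t₂ ≠ t₄

/-- **Pole pair (five-fold bond)**: `z` is a shell point of `y` and some decahedral matching of the shell of `y` sends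
`z` to a pole `±e₃`. By the landed pole lemma the relation chains axis sites pole-to-pole into bi-infinite columns. [folklore] -/
def IsPolePair (S : Set E3) (y z : E3) : Prop :=
  ∃ hz : z ∈ firstShell S y, ∃ A : E3 →ₗᵢ[ℝ] E3, ∃ e : ↥(firstShell S y) ≃ ↥decaPattern,
    IsTolMatching S y A Subtype.val e ∧ (((e ⟨z, hz⟩ : ↥decaPattern) : E3) = !₂[(0 : ℝ), 0, 1] ∨
      ((e ⟨z, hz⟩ : ↥decaPattern) : E3) = !₂[(0 : ℝ), 0, -1])

/-- **Shell symmetry at `S`** — the conclusion of the landed `stub_dr5_shellMutual`, specialised to `S`. [folklore] -/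
def ShellSymmetric (S : Set E3) : Prop :=
  ∀ y ∈ S, ∀ z ∈ S, z ≠ y → dist z y < 13 / 10 * nearestDist S y →
    nearestDist S y ≤ dist z y ∧ dist z y ≤ 21 / 20 * nearestDist S y ∧
      dist y z < 13 / 10 * nearestDist S z ∧ dist y z ≤ 21 / 20 * nearestDist S z

/-- **Links are pattern adjacency at `S`** — the conclusion of the landed `stub_dr5_links`, specialised to `S`: for any
pattern `P` of unit vectors, pairwise `≥ 1` apart, with no pair distance in `(26/25, 7/5)`, and any tolerance matching
of a shell onto `P`, shell-adjacency of two distinct shell-mates is adjacency of their pattern images. [folklore] -/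
def LinksArePatterns (S : Set E3) : Prop :=
  ∀ P : Set E3, (∀ p ∈ P, ‖p‖ = 1) → (∀ p ∈ P, ∀ q ∈ P, p ≠ q → 1 ≤ dist p q) →
    (∀ p ∈ P, ∀ q ∈ P, dist p q ≤ 26 / 25 ∨ 7 / 5 ≤ dist p q) →
    ∀ y ∈ S, ∀ A : E3 →ₗᵢ[ℝ] E3, ∀ e : ↥(firstShell S y) ≃ ↥P, IsTolMatching S y A Subtype.val e →
      ∀ t t' : ↥(firstShell S y), t ≠ t' → ((t' : E3) ∈ firstShell S t ↔ dist ((e t : ↥P) : E3) (e t') ≤ 26 / 25)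

/-- **Square faces are capped at `S`** (octahedron completion) — the conclusion of the landed `stub_dr5_capping`,
specialised to `S`. [folklore] -/
def SquaresCapped (S : Set E3) : Prop :=
  ∀ y ∈ S, ∀ t₁ t₂ t₃ t₄ : E3, IsSquareFace S y t₁ t₂ t₃ t₄ →
    ∃ x ∈ S, x ≠ y ∧ x ∉ firstShell S y ∧ x ∈ firstShell S t₁ ∧ x ∈ firstShell S t₂ ∧
      x ∈ firstShell S t₃ ∧ x ∈ firstShell S t₄

/-- **Column family at `S`** — the conclusion of the landed `stub_dr5_chains` (birth skeleton's (c1)–(c3)),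
specialised to `S`: bi-infinite pole-to-pole chains through every axis site. [folklore] -/
def HasColumns (S : Set E3) : Prop :=
  ∃ Γ : Set (ℤ → E3), (∀ y ∈ axisSites S, ∃ γ ∈ Γ, ∃ n : ℤ, γ n = y) ∧ (∀ γ ∈ Γ, ∀ n : ℤ, γ n ∈ axisSites S) ∧
    ∀ γ ∈ Γ, ∀ n : ℤ, ∃ A : E3 →ₗᵢ[ℝ] E3, (∃ e : ↥(firstShell S (γ n)) ≃ ↥decaPattern, IsTolMatching S (γ n) A Subtype.val e) ∧
      dist ((nearestDist S (γ n))⁻¹ • (γ (n + 1) - γ n)) (A (!₂[(0 : ℝ), 0, 1])) ≤ 1 / 20 ∧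
      dist ((nearestDist S (γ n))⁻¹ • (γ (n - 1) - γ n)) (A (!₂[(0 : ℝ), 0, -1])) ≤ 1 / 20

/-- **The per-`S` front end of line `Sketch`** (all four LANDED as stubs of crux stmt-AtomisticToContinuum-15799). [folklore] -/
def FrontEnd (S : Set E3) : Prop := ShellSymmetric S ∧ LinksArePatterns S ∧ SquaresCapped S ∧ HasColumns S

/-- **Layer inequality at `S`** (the conclusion of the open core stub `stub_dr5_core` of line `Sketch`): the
"area + forest + boundary layer" inequality of card sheet-area-strip-forest for the axis-count profile about every
centre, with constants depending on `S`. Together with the packing bound and the landed bootstrap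
(`stub_dr5_layerBootstrap`) it gives the crux. [folklore] -/
def LayerInequality (S : Set E3) : Prop :=
  ∃ C₁ W₀ : ℝ, ∀ c : E3, ∀ W r : ℝ, W₀ ≤ W → 16 * W ≤ r →
    axisCount S c (r - 6 * W) ≤ C₁ * r ^ 3 / W + (axisCount S c (r - 4 * W) - axisCount S c (r - 8 * W)) / 3

/-- **Linear axis census at `S`** (the intended conclusion of the comparison-geometry engine, constant depending on
`S`): at most `C·(L + 1)` axis sites in any closed ball of radius `L`. It implies `LayerInequality S` (bracket term
dropped) and, uniformly, the crux (IdeatorOne's proved bridge needs the absolute-constant form `C·(L/δ + 1)`). [folklore] -/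
def LinearAxisCensusAt (S : Set E3) : Prop :=
  ∃ C : ℝ, ∀ c : E3, ∀ L : ℝ, 0 ≤ L → axisCount S c L ≤ C * (L + 1)

/-! ## Line `Sketch`, skeleton v7 (lead prover-line-…-15799-c1, 2026-08-17): the sheet vocabulary

The open core `IsAdmissible δ S → FrontEnd S → LayerInequality S` is re-lined through the STRIP FOREST of card
sheet-area-strip-forest, stated entirely in the combinatorics of shell membership (no matchings, no real geometry):
the *layer* of an hcp-like site is read off its link (`Equatorial` = "this link edge lies in two link triangles",
true exactly for the six in-plane neighbours of an anticuboctahedral shell, for no neighbour of a cuboctahedral one),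
straight in-layer continuation (`Straight` = opposite vertices of that hexagon) generates ROWS of hcp-like sites
leaving an axis site through a ring site and ending only at axis sites (`HasRow`); sheets / columns are the classes of
`sheetRel` / `colRel`.  `SheetAxioms S` collects the LOCAL facts (pattern level), `StripForest S` the ONE GLOBAL fact
(no flat tube: fans of an axis lie in distinct sheets, no row returns to its own column, and the column–sheet
incidence is oriented like a rooted forest), `ChildLayerInequality S` the resulting census inequality
(`f(ρ) ≤ C(1+ρ+κW)³/W + f(ρ+κW)/4`, whose bootstrap to density zero is a convergent geometric series). -/

/-- **fcc-like**: the shell of `y` is `1/20`-matched to the cuboctahedron `fccKissingPattern`. [folklore] -/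
def IsFccLike (S : Set E3) (y : E3) : Prop :=
  ∃ A : E3 →ₗᵢ[ℝ] E3, ∃ e : ↥(firstShell S y) ≃ ↥fccKissingPattern, IsTolMatching S y A Subtype.val e

/-- **hcp-like**: the shell of `y` is `1/20`-matched to the anticuboctahedron `hcpKissingPattern`. [folklore] -/
def IsHcpLike (S : Set E3) (y : E3) : Prop :=
  ∃ A : E3 →ₗᵢ[ℝ] E3, ∃ e : ↥(firstShell S y) ≃ ↥hcpKissingPattern, IsTolMatching S y A Subtype.val e

/-- {fcc,hcp}-good means fcc-like or hcp-like (unfolding). -/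
theorem isFccHcpGood_iff_like {S : Set E3} {y : E3} : IsFccHcpGood S y ↔ IsFccLike S y ∨ IsHcpLike S y := by
  constructor
  · rintro ⟨A, ⟨e, he⟩ | ⟨e, he⟩⟩
    · exact Or.inl ⟨A, e, he⟩
    · exact Or.inr ⟨A, e, he⟩
  · rintro (⟨A, e, he⟩ | ⟨A, e, he⟩)
    · exact ⟨A, Or.inl ⟨e, he⟩⟩
    · exact ⟨A, Or.inr ⟨e, he⟩⟩

/-- **In-layer (equatorial) neighbour**: `p` is a shell-mate of `x` and some link edge `(p, a)` of the link of `x`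
lies in two link triangles `(p, a, b)`, `(p, a, c)` — all memberships read in first shells.  For an hcp-like `x` these
are exactly the six shell-mates in its close-packed reflection plane; an fcc-like `x` has none (every edge of the
cuboctahedron lies in one triangle); for a ring site `t` of an axis site `y`, `y` is equatorial for `t`.  Symmetric in
`(x, p)` up to shell symmetry (`equatorial_symm`). [folklore] -/
def Equatorial (S : Set E3) (x p : E3) : Prop :=
  p ∈ firstShell S x ∧ ∃ a b c : E3, a ∈ firstShell S x ∧ b ∈ firstShell S x ∧ c ∈ firstShell S x ∧
    a ∈ firstShell S p ∧ b ≠ c ∧ b ∈ firstShell S p ∧ b ∈ firstShell S a ∧ c ∈ firstShell S p ∧ c ∈ firstShell S a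

/-- **Straight in-layer continuation** through `x`: `p` and `q` are distinct equatorial neighbours of `x`, not
shell-mates of each other and without a common shell-mate inside the shell of `x` — for an hcp-like `x`, exactly the
three antipodal pairs of its in-layer hexagon. [folklore] -/
def Straight (S : Set E3) (x p q : E3) : Prop :=
  Equatorial S x p ∧ Equatorial S x q ∧ p ≠ q ∧ q ∉ firstShell S p ∧
    ∀ r ∈ firstShell S x, ¬ (r ∈ firstShell S p ∧ r ∈ firstShell S q)

/-- `Equatorial` is symmetric once shells are (`x ∈ T_p`): the same three witnesses serve. -/
theorem equatorial_symm {S : Set E3} {x p : E3} (hx : x ∈ firstShell S p) (h : Equatorial S x p) :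
    Equatorial S p x := by
  obtain ⟨-, a, b, c, hax, hbx, hcx, hap, hbc, hbp, hba, hcp, hca⟩ := h
  exact ⟨hx, a, b, c, hap, hbp, hcp, hax, hbc, hbx, hba, hcx, hca⟩

/-- **Same sheet**: in-layer connectivity through hcp-like sites (reflexive–transitive closure). [folklore] -/
def sheetRel (S : Set E3) : E3 → E3 → Prop :=
  Relation.ReflTransGen fun u v => IsHcpLike S u ∧ IsHcpLike S v ∧ Equatorial S u v

/-- **Same column**: connectivity of axis sites through axis shell-mates (the pole-to-pole bonds). [folklore] -/
def colRel (S : Set E3) : E3 → E3 → Prop :=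
  Relation.ReflTransGen fun u v => u ∈ axisSites S ∧ v ∈ axisSites S ∧ v ∈ firstShell S u

/-- **Row** of `n` non-axis sites from the axis site `a` through its ring site `t`, ending at the axis site `b`:
`x₀ = a`, `x₁ = t`, `x_{n+1} = b`, and `x_{j+1}` is the straight continuation of `x_{j-1}` through `x_j` for
`1 ≤ j ≤ n`.  (`n = 0` is impossible: `t` is not an axis site.) [folklore] -/
def HasRow (S : Set E3) (a t : E3) (n : ℕ) (b : E3) : Prop :=
  ∃ x : ℕ → E3, x 0 = a ∧ x 1 = t ∧ x (n + 1) = b ∧ a ∈ axisSites S ∧ t ∈ firstShell S a ∧ t ∉ axisSites S ∧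
    b ∈ axisSites S ∧ ∀ j : ℕ, 1 ≤ j → j ≤ n → x j ∉ axisSites S ∧ Straight S (x j) (x (j - 1)) (x (j + 1))

/-- **`W`-narrow axis site**: every row leaving `a` (one through each non-axis shell-mate) ends at an axis site after
fewer than `W` steps — all five fans of `a` are strips of width `< W` near `a`. [folklore] -/
def IsNarrow (W : ℝ) (S : Set E3) (a : E3) : Prop :=
  a ∈ axisSites S ∧ ∀ t ∈ firstShell S a, t ∉ axisSites S → ∃ n : ℕ, ∃ b : E3, (n : ℝ) < W ∧ HasRow S a t n b

/-- **Local sheet axioms at `S`** (pattern-level consequences of the landed front end; the provable part of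
skeleton v7): (A1) an fcc-like site has no equatorial shell-mate; (A2) at an hcp-like site every equatorial
shell-mate has a unique straight continuation; (A3) an hcp-like site has at most six equatorial shell-mates; (A4) an
equatorial shell-mate of an hcp-like site is not fcc-like (layers do not end inside good material); (A5) a non-axis
shell-mate `t` (ring site) of an axis site `y` sees `y` in its layer; (A6) among the ring sites of `y`, each ring
site has at most one in-layer partner (its mate in the same fan); (A7) an axis site has ten distinct ring sites. [folklore] -/
def SheetAxioms (S : Set E3) : Prop :=
  (∀ x p : E3, IsFccLike S x → ¬ Equatorial S x p) ∧
  (∀ x p : E3, IsHcpLike S x → Equatorial S x p → ∃ q : E3, Straight S x p q ∧ ∀ q' : E3, Straight S x p q' → q' = q) ∧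
  (∀ x : E3, IsHcpLike S x → ∃ h : Fin 6 → E3, ∀ p : E3, Equatorial S x p → ∃ i : Fin 6, h i = p) ∧
  (∀ x p : E3, IsHcpLike S x → Equatorial S x p → ¬ IsFccLike S p) ∧
  (∀ y t : E3, y ∈ axisSites S → t ∈ firstShell S y → t ∉ axisSites S → Equatorial S t y) ∧
  (∀ y t t' t'' : E3, y ∈ axisSites S → t ∈ firstShell S y → t ∉ axisSites S → t' ∈ firstShell S y →
      t' ∉ axisSites S → t'' ∈ firstShell S y → t'' ∉ axisSites S → t' ≠ t → t'' ≠ t →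
      Equatorial S t t' → Equatorial S t t'' → t' = t'') ∧
  (∀ y : E3, y ∈ axisSites S → ∃ g : Fin 10 → E3, Function.Injective g ∧ ∀ i : Fin 10, g i ∈ firstShell S y ∧ g i ∉ axisSites S)

/-- **Strip forest at `S`** — the ONE global ingredient of skeleton v7 (no flat tube in the ideal octet complex;
crux-sized): (F1) two ring sites of an axis site lying in a common sheet are equal or in-layer adjacent (the five fans
of an axis lie in five distinct sheets; no self-strip); (F2) no row returns to the column it left; (F3) the
column–sheet incidence ("some site of the column has a ring site in the sheet") is oriented like a rooted forest:
there are a parent-sheet assignment `ps` (constant on columns) and a parent-column assignment `pc` (constant on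
sheets) such that at every incidence the sheet is the column's parent or the column is the sheet's parent.  Implied by
acyclicity of the strip graph; equivalent in use to "every component has at most one cycle". [folklore] -/
def StripForest (S : Set E3) : Prop :=
  (∀ b t t' : E3, b ∈ axisSites S → t ∈ firstShell S b → t ∉ axisSites S → t' ∈ firstShell S b → t' ∉ axisSites S →
      sheetRel S t t' → t = t' ∨ Equatorial S t t') ∧
  (∀ a t : E3, ∀ n : ℕ, ∀ b : E3, HasRow S a t n b → ¬ colRel S a b) ∧
  (∃ ps pc : E3 → Set E3, (∀ a a' : E3, colRel S a a' → ps a = ps a') ∧ (∀ t t' : E3, sheetRel S t t' → pc t = pc t') ∧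
    ∀ a t : E3, a ∈ axisSites S → t ∈ firstShell S a → t ∉ axisSites S →
      ps a = {u : E3 | sheetRel S t u} ∨ pc t = {u : E3 | colRel S a u})

/-- **Child layer inequality at `S`** (conclusion of the counting of skeleton v7): wide axis sites pay row area
`W` out of a cubic volume, narrow ones are a quarter of the axis sites one layer `κW` further out (each narrow site
charges eight rows to sites of child columns, each charged at most twice). Its bootstrap is a geometric series:
`f(ρ) ≤ 128·C₁ρ³/W` for `ρ ≥ max 1 (κW)`, hence density zero. [folklore] -/
def ChildLayerInequality (S : Set E3) : Prop :=
  ∃ C₁ κ : ℝ, 0 ≤ κ ∧ ∀ c : E3, ∀ W ρ : ℝ, 1 ≤ W → 0 ≤ ρ →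
    axisCount S c ρ ≤ C₁ * (1 + ρ + κ * W) ^ 3 / W + axisCount S c (ρ + κ * W) / 4

end Summit.AtomisticToContinuum.Crystallization.Theorems.FiveFoldRation

end
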